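import Mathlib
import HarnessLib
import Summits.HubbardSuperconductivity.HubbardSuperconductivity.Theorems.KLProgrammeDispersionFlowEnvelope
import Summits.HubbardSuperconductivity.HubbardSuperconductivity.Theorems.KLProgrammeKLRegimeSplitCounterMap
import Summits.HubbardSuperconductivity.HubbardSuperconductivity.Theorems.KLProgrammeKLRegimeSplitTwoLegAngular
import Summits.HubbardSuperconductivity.HubbardSuperconductivity.Theorems.KLProgrammeKLRegimeEngineV8DefsQ2

/-!
# Route `KLProgramme` — crux K3, ENGINE child `KLRegimeEngineV11` (stmt-HubbardSuperconductivity-19823), the two-leg stubs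
# `stub_twoLeg_scale0` / `stub_twoLeg_step`: TWO GENERIC REDUCTIONS of the two-leg slot `TwoLegStepV11 … n` —
# (E3b-G) the tangential FLOOR from the (E3a-G) order-2 SIZE whenever `twoLegBar 2 n ≤ bflBar n` (always at `n = 0` for the package of
# record `klEngGeo` / `klEngQ2 P R`), and (E3g) the ANGULAR REGULARITY of the local part from MOMENTUM regularity of the two-leg
# interpolant `D_n(K) = klTwoLegPoly … K n` and the `C⁴` regularity of the frame's Fermi-point map `θ ↦ k_F^K(θ)` (chain rule,
# `norm_iteratedFDeriv_comp_le`) — cell gate-hubbard-kl, seat p1b (g5)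

Why.  The engine slot `EngineBoundsAtV7S … n` carries NO two-leg conjunct ((E1-v4) is `p ≥ 2`, i.e. `≥ 4` legs; the ladder / value /
moment / isotropy clauses are four-leg), so the two registered two-leg stubs of the V11 engine skeleton
(`stub_twoLeg_scale0 : … → EngineBoundsAtV7S … 0 → TwoLegStepV11 … 0`, `stub_twoLeg_step`) must produce ALL SEVEN two-leg clauses
(`TwoLegSizesG`, `TwoLegFloorG`, `FrameLipschitzG`, `TwoLegSlopes`, `TwoLegSizesMS`, `TwoLegAngularG`, `TwoLegVolumeRate`) from the model's
scale-`n` self-energy.  Two of them are CONSEQUENCES of momentum-space data the same analysis yields anyway: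

* §1 `twoLegFloorG_of_sizes`: `TwoLegSizesG … n` (tier 1, `j = 2`) and `twoLegBar G Q U 2 n ≤ bflBar G Q U n` ⇒ `TwoLegFloorG … n`
  (`|hessQuad f p t| ≤ ‖D²f(p)‖·‖t‖²`); the inequality of majorants holds at `n = 0` iff `G.S 2 ≤ G.Bf ∧ Q.S' 2 ≤ Q.Bf`
  (`twoLegBar_two_zero_le_bflBar_zero`), which the package of record satisfies with equality (`twoLegFloorG_zero_of_sizes_klEng`:
  at `klEngGeo` / `klEngQ2 P R`, (E3a-G)₀ ⇒ (E3b-G)₀ — one of the seven clauses of `stub_twoLeg_scale0` is free).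
* §2 `twoLegAngularG_of_curve_bounds`: the local part is `ν_n(K) = evalM (D_n(K)) ∘ (toLp ∘ k_F^K)` (`klLocalPart_eq_comp`); if
  `‖Dⁱ evalM (D_n(K))‖ ≤ C` for `i ≤ 4` (momentum regularity of the two-leg interpolant — controlled by the position-space moments of the
  scale-`n` two-leg kernel through p1b g4's `norm_iteratedFDeriv_evalM_le_coeffNorm` + `coeffNorm_symInterp_le`) and the Fermi-point map is
  `C⁴` with `‖Dⁱ(toLp ∘ k_F^K)‖ ≤ Dⁱ` for `1 ≤ i ≤ 4` (frame-side: p4's `contDiff_klFermiPoint` gives `C^∞`; the quantitative orders `2…4`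
  are the implicit-function bounds of the frame band), then `θ ↦ ν_n(K)(θ)` is `C⁴` with `|∂_θ^j ν_n| ≤ j!·C·D^j`
  (`abs_iteratedDeriv_klLocalPart_le`), hence (E3g) `TwoLegAngularG … n` as soon as `j!·C·D^j ≤ angBar G Q R U (nScales β) j`, `1 ≤ j ≤ 4`.

Proofs only; nothing is asserted about the Hubbard model.
-/

noncomputable section

namespace Summit.HubbardSuperconductivity.HubbardSuperconductivity.Theorems.KLRegimeSplit

set_option linter.dupNamespace false -- summit = problem name (single-conjunct summit), D-0017

open scoped InnerProductSpace
open Real Finset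
open Literature.MathematicalPhysics.QuantumLattice Literature.Probability.LatticeModels
open Literature.MathematicalPhysics.QuantumLattice.FermiRG
open Summit.HubbardSuperconductivity.HubbardSuperconductivity.Theorems.KLProgrammeLegKernels
open Summit.HubbardSuperconductivity.HubbardSuperconductivity.Theorems.DispersionFlow
open Summit.HubbardSuperconductivity.HubbardSuperconductivity.Theorems.EngineV8

/-! ## §1 (E3b-G) the floor from the (E3a-G) order-2 size -/

/-- **The Hessian form is bounded below by minus the second-derivative norm**: `−‖D²f(p)‖·‖t‖² ≤ hessQuad f p t`. -/
theorem neg_norm_iteratedFDeriv_two_mul_le_hessQuad (f : Momentum → ℝ) (p t : Momentum) :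
    -(‖iteratedFDeriv ℝ 2 f p‖ * ‖t‖ ^ 2) ≤ hessQuad f p t := by
  rw [hessQuad_eq_fderiv_fderiv]
  have h := abs_fderiv_fderiv_le f p t t
  rw [abs_le] at h
  nlinarith [h.1]

section Model

variable {L M : ℕ} [NeZero L] [NeZero M]

/-- **(E3a-G) order 2 ⇒ (E3b-G)** whenever the size majorant is below the floor majorant: `TwoLegSizesG … n` and
`twoLegBar G Q U 2 n ≤ bflBar G Q U n` give `TwoLegFloorG … n` (the floor `−bflBar·‖t‖²` is implied by `|hessQuad| ≤ ‖D²ℓ_n‖·‖t‖²`,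
no tangency or tube condition used). -/
theorem twoLegFloorG_of_sizes {G : GeoConsts} {Q : EngConsts} {R : RenConsts} {β U μ : ℝ} {K : TrigPolyC4v} {n : ℕ}
    (hsz : TwoLegSizesG L M G Q R β U μ K n) (hle : twoLegBar G Q U 2 n ≤ bflBar G Q U n) :
    TwoLegFloorG L M G Q β U μ K n := by
  intro p _ t _
  have h2 := hsz.1 2 le_rfl p
  have hq := neg_norm_iteratedFDeriv_two_mul_le_hessQuad (evalM (klTwoLegPieceG L M β U μ K n)) p t
  have ht : 0 ≤ ‖t‖ ^ 2 := sq_nonneg _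
  nlinarith [mul_le_mul_of_nonneg_right (h2.trans hle) ht]

end Model

/-- **The majorant inequality at scale `0`**: `twoLegBar G Q U 2 0 ≤ bflBar G Q U 0` as soon as `G.S 2 ≤ G.Bf` and `Q.S' 2 ≤ Q.Bf`
(`twoLegBar 2 0 = (S 2 + S' 2·|U|)·U²`, `bflBar 0 = Bf·U² + Bf'·|U|³`). -/
theorem twoLegBar_two_zero_le_bflBar_zero {G : GeoConsts} {Q : EngConsts} (hS : G.S 2 ≤ G.Bf) (hS' : Q.S' 2 ≤ Q.Bf) (U : ℝ) :
    twoLegBar G Q U 2 0 ≤ bflBar G Q U 0 := by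
  unfold twoLegBar bflBar uPow
  simp only [Nat.cast_zero, mul_zero, zpow_zero, mul_one, neg_zero, Real.rpow_zero]
  have hU2 : 0 ≤ U ^ 2 := sq_nonneg U
  have hU3 : |U| ^ 3 = |U| * U ^ 2 := by rw [pow_succ, pow_two, ← sq_abs]; ring
  rw [hU3]
  have h2 : ¬ (2 : ℕ) = 0 := by norm_num
  simp only [h2, ↓reduceIte]
  nlinarith [mul_le_mul_of_nonneg_right hS hU2, mul_le_mul_of_nonneg_right hS' (mul_nonneg (abs_nonneg U) hU2),
    abs_nonneg U]

section Model

variable {L M : ℕ} [NeZero L] [NeZero M]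

/-- **(E3a-G)₀ ⇒ (E3b-G)₀** for constants with `G.S 2 ≤ G.Bf`, `Q.S' 2 ≤ Q.Bf`. -/
theorem twoLegFloorG_zero_of_sizes {G : GeoConsts} {Q : EngConsts} {R : RenConsts} (hS : G.S 2 ≤ G.Bf) (hS' : Q.S' 2 ≤ Q.Bf)
    {β U μ : ℝ} {K : TrigPolyC4v} (hsz : TwoLegSizesG L M G Q R β U μ K 0) : TwoLegFloorG L M G Q β U μ K 0 :=
  twoLegFloorG_of_sizes hsz (twoLegBar_two_zero_le_bflBar_zero hS hS' U)

/-- **(E3a-G)₀ ⇒ (E3b-G)₀ AT THE PACKAGE OF RECORD** `klEngGeo` / `klEngQ2 P R` (`S 2 = Bf = 2^10`, `S' 2 = Bf = 2^20·klEngPsq²·klEngRsq²`):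
the floor clause of `stub_twoLeg_scale0` follows from its size clause. -/
theorem twoLegFloorG_zero_of_sizes_klEng (P : SplitConsts) (R : RenConsts) {β U μ : ℝ} {K : TrigPolyC4v}
    (hsz : TwoLegSizesG L M klEngGeo (klEngQ2 P R) R β U μ K 0) : TwoLegFloorG L M klEngGeo (klEngQ2 P R) β U μ K 0 :=
  twoLegFloorG_zero_of_sizes (le_of_eq rfl) (le_of_eq rfl) hsz

end Model

/-! ## §2 (E3g) angular regularity from momentum regularity and the curve -/

section Model

variable (L M : ℕ) [NeZero L] [NeZero M]

/-- **The local part is the two-leg interpolant read along the Fermi-point map**: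
`ν_n(K) = evalM (klTwoLegPoly … K n) ∘ (θ ↦ toLp 2 (k_F^K θ))`. -/
theorem klLocalPart_eq_comp (β U μ : ℝ) (K : TrigPolyC4v) (n : ℕ) :
    klLocalPart L M β U μ K n =
      evalM (klTwoLegPoly L M β U μ K n) ∘ fun θ => (WithLp.toLp 2 (klFermiPoint μ K θ) : Momentum) := by
  funext θ
  rfl

variable {L M}

/-- **Angular derivatives of the local part from the chain rule.**  If `‖Dⁱ evalM (D_n(K))‖ ≤ C` on `Momentum` for `i ≤ m` and the
Fermi-point map `γ = toLp ∘ k_F^K` is `C^m` with `‖Dⁱ γ(θ)‖ ≤ Dⁱ` for `1 ≤ i ≤ m`, then `|∂_θ^m ν_n(K)(θ)| ≤ m!·C·D^m`. -/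
theorem abs_iteratedDeriv_klLocalPart_le {β U μ : ℝ} {K : TrigPolyC4v} {n m : ℕ} {C D : ℝ}
    (hC : ∀ i ≤ m, ∀ q : Momentum, ‖iteratedFDeriv ℝ i (evalM (klTwoLegPoly L M β U μ K n)) q‖ ≤ C)
    (hγ : ContDiff ℝ m fun θ => (WithLp.toLp 2 (klFermiPoint μ K θ) : Momentum))
    (hD : ∀ i, 1 ≤ i → i ≤ m → ∀ θ : ℝ,
      ‖iteratedDeriv i (fun θ => (WithLp.toLp 2 (klFermiPoint μ K θ) : Momentum)) θ‖ ≤ D ^ i) (θ : ℝ) :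
    |iteratedDeriv m (klLocalPart L M β U μ K n) θ| ≤ m.factorial * C * D ^ m := by
  rw [← Real.norm_eq_abs, ← norm_iteratedFDeriv_eq_norm_iteratedDeriv, klLocalPart_eq_comp]
  refine norm_iteratedFDeriv_comp_le (N := (m : ℕ∞)) (contDiff_evalM _) (by exact_mod_cast hγ) le_rfl θ
    (fun i hi => hC i hi _) fun i hi1 hi2 => ?_
  rw [norm_iteratedFDeriv_eq_norm_iteratedDeriv]
  exact hD i hi1 hi2 θ

/-- **(E3g) FROM MOMENTUM REGULARITY AND THE CURVE.**  Orders `≤ 4`: `‖Dⁱ evalM (D_n(K))‖ ≤ C` (`i ≤ 4`), `γ = toLp ∘ k_F^K` of class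
`C⁴` with `‖Dⁱγ‖ ≤ Dⁱ` (`1 ≤ i ≤ 4`), and the fit `j!·C·D^j ≤ angBar G Q R U (nScales β) j` (`1 ≤ j ≤ 4`) give `TwoLegAngularG … K n`. -/
theorem twoLegAngularG_of_curve_bounds {G : GeoConsts} {Q : EngConsts} {R : RenConsts} {β U μ : ℝ} {K : TrigPolyC4v} {n : ℕ}
    {C D : ℝ} (hC : ∀ i ≤ 4, ∀ q : Momentum, ‖iteratedFDeriv ℝ i (evalM (klTwoLegPoly L M β U μ K n)) q‖ ≤ C)
    (hγ : ContDiff ℝ 4 fun θ => (WithLp.toLp 2 (klFermiPoint μ K θ) : Momentum))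
    (hD : ∀ i, 1 ≤ i → i ≤ 4 → ∀ θ : ℝ,
      ‖iteratedDeriv i (fun θ => (WithLp.toLp 2 (klFermiPoint μ K θ) : Momentum)) θ‖ ≤ D ^ i)
    (hfit : ∀ j, 1 ≤ j → j ≤ 4 → (j.factorial : ℝ) * C * D ^ j ≤ angBar G Q R U (nScales β) j) :
    TwoLegAngularG L M G Q R β U μ K n := by
  refine ⟨?_, fun j hj1 hj4 θ => ?_⟩
  · rw [klLocalPart_eq_comp]
    exact (contDiff_evalM _).comp hγ
  · have hCj : ∀ i ≤ j, ∀ q : Momentum, ‖iteratedFDeriv ℝ i (evalM (klTwoLegPoly L M β U μ K n)) q‖ ≤ C :=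
      fun i hi q => hC i (hi.trans hj4) q
    have hγj : ContDiff ℝ j fun θ => (WithLp.toLp 2 (klFermiPoint μ K θ) : Momentum) :=
      hγ.of_le (by exact_mod_cast hj4)
    have hDj : ∀ i, 1 ≤ i → i ≤ j → ∀ θ : ℝ,
        ‖iteratedDeriv i (fun θ => (WithLp.toLp 2 (klFermiPoint μ K θ) : Momentum)) θ‖ ≤ D ^ i :=
      fun i hi1 hi2 θ => hD i hi1 (hi2.trans hj4) θ
    exact (abs_iteratedDeriv_klLocalPart_le hCj hγj hDj θ).trans (hfit j hj1 hj4)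

end Model

end Summit.HubbardSuperconductivity.HubbardSuperconductivity.Theorems.KLRegimeSplit

end
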